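import Summits.QuantumFields.YangMills.Theorems.ColdStartUniversalityLatticeLangevinUniquenessVec
import HarnessLib

/-!
# Route `ColdStartUniversality` (coupling infrastructure): pathwise uniqueness for Lipschitz SDE systems driven
# by Brownian coordinates of an ARBITRARY filtration

Helper file (seat `ym-line-csu-p1`, g13; `--supports stmt-QuantumFields-27872`).  The tree's pathwise-uniqueness
chain for the SU(2) SZZ dynamics (`vecPicard_contraction` → `vecSDE_pathwise_unique_of_bounded` →
`latticeLangevin_pathwise_unique`) is stated for the raw natural filtration `σ(W)` of the driving Brownian vector.
Coupling constructions (reflection / mirror / synchronous couplings; blocked item `defn-UnitScaleMixedCoupling`,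
TP 27872/27873, CSU 27403/27404) put TWO solutions on ONE filtration `𝓕` — the natural filtration of the first
noise `B` — and drive the second one by the rotated noise `B' = ∫ R dB`, which is a Brownian motion of `𝓕` only in
MARTINGALE FORM (`Literature…ItoIntegralRotation`, `…LevyCharacterisationVec*`), `𝓕 ⊋ σ(B')`.  Every uniqueness
statement about the second solution therefore needs the chain w.r.t. an arbitrary filtration; this file
generalises its first two links (same proofs, the Doob–Itô `L²` maximal inequality
`IsItoIntegral.lintegral_iSup_sub_sq_le` being already stated for general `𝓕`):

* `vecPicard_contraction_filtration` — `E[sup_{s≤t} |SU − SU'|²] ≤ C(T) E∫₀ᵗ |U − U'|²` for the Picard step;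
* ★ `vecSDE_pathwise_unique_of_bounded_filtration` — two `𝓕`-progressive, a.s. continuous, a.s. bounded
  solutions of `dX = b(X) dt + Σₙ σₙ(X) dW^{cₙ}` (globally Lipschitz `b, σ`) from the same point are
  indistinguishable.

No definition, no sorry, standard axioms.  HONEST FRAMING: plumbing; no coupling is constructed here; no crux,
rung R3 or summit is proved; the Yang–Mills mass gap is NOT proved.
-/

set_option autoImplicit false

noncomputable section

namespace Summit.QuantumFields.YangMills.Theorems.ColdStartUniversality

open MeasureTheory ProbabilityTheory Filter Topology Finset
open scoped NNReal ENNReal BigOperators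
open Literature.Probability.Process Literature.Analysis.FunctionSpaces

variable {Ω : Type*} {mΩ : MeasurableSpace Ω} {P : Measure Ω} {𝓕 : Filtration ℝ≥0 mΩ} {d : ℕ}
  {W : ℝ≥0 → Ω → (Fin d → ℝ)} {ι κ : Type*} [Fintype ι] [Fintype κ]
  {b : (ι → ℝ) → ι → ℝ} {σ : (ι → ℝ) → ι → κ → ℝ} {c : ι → κ → Fin d} {K : ℝ} {x₀ : ι → ℝ}

/-- **The contraction estimate of the vector Picard step** (RY IX (2.1):
`Φ_t(SU, SU') ≤ C E∫₀ᵗ |U_r − U'_r|² dr`): for invariant `U, U'` (coordinatewise progressive, a.s.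
continuous) and steps `V = S U`, `V' = S U'` with their Itô integrals `JV, JV'`,
`E[sup_{s≤t} Σ_i (V_i − V'_i)²(s)] ≤ (|ι|(2TK) + 8|ι||κ|²K) · E ∫₀ᵗ Σ_i (U_i − U'_i)²(r) dr` for `t ≤ T`.
Here for an ARBITRARY filtration `𝓕` in which the driving coordinates are Brownian motions in martingale form
(the tree's `vecPicard_contraction` is the case `𝓕 = σ(W)`). Revuz–Yor (1999), Ch. IX, proof of Thm (2.1).
[cite: RevuzYor1999, Ch. IX Thm (2.1)] -/
theorem vecPicard_contraction_filtration [IsProbabilityMeasure P]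
    (hBm : ∀ k, Martingale (fun t ω => W t ω k) 𝓕 P)
    (hBsq : ∀ k, Martingale (fun t ω => W t ω k ^ 2 - (t : ℝ)) 𝓕 P)
    (hB2 : ∀ t k, MemLp (fun ω => W t ω k) 2 P) (hBc : ∀ k ω, Continuous fun t => W t ω k) (hK : 0 ≤ K)
    (hb : ∀ x y : ι → ℝ, ∑ i, (b x i - b y i) ^ 2 ≤ K * ∑ i, (x i - y i) ^ 2)
    (hσ : ∀ x y : ι → ℝ, ∑ i, ∑ n, (σ x i n - σ y i n) ^ 2 ≤ K * ∑ i, (x i - y i) ^ 2)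
    {U U' V V' : ι → ℝ≥0 → Ω → ℝ} {JV JV' : ι → κ → ℝ≥0 → Ω → ℝ}
    (hU : ∀ i, IsStronglyProgressive 𝓕 (U i)) (hUc : ∀ᵐ ω ∂P, ∀ i, Continuous fun t => U i t ω)
    (hU' : ∀ i, IsStronglyProgressive 𝓕 (U' i))
    (hU'c : ∀ᵐ ω ∂P, ∀ i, Continuous fun t => U' i t ω)
    (hJV : ∀ i n, IsItoIntegral (fun s ω => σ (fun j => U j s ω) i n) (fun s ω => W s ω (c i n)) (JV i n)
        𝓕 P ∧ IsStronglyProgressive 𝓕 (JV i n))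
    (hV : ∀ i t ω, V i t ω = x₀ i + timeIntegral (fun s ω => b (fun j => U j s ω) i) t ω + ∑ n, JV i n t ω)
    (hJV' : ∀ i n, IsItoIntegral (fun s ω => σ (fun j => U' j s ω) i n) (fun s ω => W s ω (c i n)) (JV' i n)
        𝓕 P ∧ IsStronglyProgressive 𝓕 (JV' i n))
    (hV' : ∀ i t ω, V' i t ω = x₀ i + timeIntegral (fun s ω => b (fun j => U' j s ω) i) t ω + ∑ n, JV' i n t ω)
    (T : ℝ≥0) :
    ∀ t ≤ T, ∫⁻ ω, ⨆ s ∈ Set.Iic t, ENNReal.ofReal (∑ i, (V i s ω - V' i s ω) ^ 2) ∂P ≤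
      ((Fintype.card ι : ℝ≥0∞) * ENNReal.ofReal (2 * T * K) +
          8 * (Fintype.card ι : ℝ≥0∞) * (Fintype.card κ : ℝ≥0∞) ^ 2 * ENNReal.ofReal K) *
        ∫⁻ ω, (∫⁻ r in Set.Icc (0 : ℝ) t,
          ENNReal.ofReal (∑ i, (U i r.toNNReal ω - U' i r.toNNReal ω) ^ 2)) ∂P := by
  intro t ht
  have hb' := vecPicard_coord_sq_le_of_sum hb
  have hσ' := vecPicard_coord_sq_le_of_sum₂ hσ
  have hbcont : ∀ i, Continuous fun x => b x i := fun i => vecPicard_continuous_coord hK hb' i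
  have hσcont : ∀ i n, Continuous fun x => σ x i n := fun i n =>
    vecPicard_continuous_coord (f := fun x (p : ι × κ) => σ x p.1 p.2) hK hσ' (i, n)
  -- abbreviations
  set E : ℝ≥0 → Ω → ℝ := fun r ω => ∑ j, (U j r ω - U' j r ω) ^ 2 with hEdef
  have hE0 : ∀ r ω, 0 ≤ E r ω := fun r ω => Finset.sum_nonneg fun _ _ => sq_nonneg _
  have hEprog : IsStronglyProgressive 𝓕 E := vecPicard_isStronglyProgressive_sumSq hU hU'
  have hIm : Measurable fun ω => ∫⁻ r in Set.Icc (0 : ℝ) t, ENNReal.ofReal (E r.toNNReal ω) :=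
    vecPicard_measurable_lintegral_Icc hEprog t
  -- Step A: pathwise bound, almost surely
  have hpath : ∀ᵐ ω ∂P, ⨆ s ∈ Set.Iic t, ENNReal.ofReal (∑ i, (V i s ω - V' i s ω) ^ 2) ≤
      (Fintype.card ι : ℝ≥0∞) * (ENNReal.ofReal (2 * t * K) *
          ∫⁻ r in Set.Icc (0 : ℝ) t, ENNReal.ofReal (E r.toNNReal ω)) +
        2 * ((Fintype.card κ : ℝ≥0∞) * ∑ i, ∑ n,
          ⨆ s ∈ Set.Iic t, ENNReal.ofReal ((JV i n s ω - JV' i n s ω) ^ 2)) := by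
    filter_upwards [hUc, hU'c] with ω hωU hωU'
    -- per coordinate
    have hcoord : ∀ i, ⨆ s ∈ Set.Iic t, ENNReal.ofReal ((V i s ω - V' i s ω) ^ 2) ≤
        ENNReal.ofReal (2 * t * K) * (∫⁻ r in Set.Icc (0 : ℝ) t, ENNReal.ofReal (E r.toNNReal ω)) +
          2 * ⨆ s ∈ Set.Iic t, ENNReal.ofReal ((∑ n, (JV i n s ω - JV' i n s ω)) ^ 2) := by
      intro i
      have hEc : Continuous fun r => E r ω := by
        simp only [hEdef]
        exact continuous_finsetSum _ fun j _ => ((hωU j).sub (hωU' j)).pow 2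
      have hec : Continuous fun r => Real.sqrt (E r ω) := Real.continuous_sqrt.comp hEc
      obtain ⟨M, hM⟩ : ∃ M, ∀ s ≤ t, |Real.sqrt (E s ω)| ≤ M := by
        obtain ⟨M, hM⟩ := (isCompact_Icc (a := (0 : ℝ≥0)) (b := t)).exists_bound_of_continuousOn
          hec.continuousOn
        exact ⟨M, fun s hs => by simpa [Real.norm_eq_abs] using hM s ⟨bot_le, hs⟩⟩
      have hgc : Continuous fun r => b (fun j => U j r ω) i - b (fun j => U' j r ω) i :=
        ((hbcont i).comp (continuous_pi fun j => hωU j)).sub ((hbcont i).comp (continuous_pi fun j => hωU' j))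
      have hintU : ∀ s : ℝ≥0, IntervalIntegrable (fun r : ℝ => b (fun j => U j r.toNNReal ω) i) volume 0 s :=
        fun s => ((hbcont i).comp (continuous_pi fun j => (hωU j).comp
          continuous_real_toNNReal)).intervalIntegrable _ _
      have hintU' : ∀ s : ℝ≥0, IntervalIntegrable (fun r : ℝ => b (fun j => U' j r.toNNReal ω) i) volume 0 s :=
        fun s => ((hbcont i).comp (continuous_pi fun j => (hωU' j).comp
          continuous_real_toNNReal)).intervalIntegrable _ _
      have h := iSup_sq_le_of_integral_repr (K := Real.sqrt K) (M := M) (t := t)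
        (d := fun s => V i s ω - V' i s ω)
        (j := fun s => ∑ n, (JV i n s ω - JV' i n s ω))
        (g := fun r => b (fun j => U j r ω) i - b (fun j => U' j r ω) i)
        (e := fun r => Real.sqrt (E r ω)) (Real.sqrt_nonneg K) (fun s => ?_) (fun r => ?_) hM
        (hgc.comp continuous_real_toNNReal).measurable (hec.comp continuous_real_toNNReal).measurable
      · have hKK : Real.sqrt K ^ 2 = K := Real.sq_sqrt hK
        have hee : ∀ r : ℝ, Real.sqrt (E r.toNNReal ω) ^ 2 = E r.toNNReal ω := fun r =>
          Real.sq_sqrt (hE0 _ _)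
        simp only [hKK, hee] at h
        exact h
      · -- the representation `d s = ∫₀ˢ g + j s`
        simp only [hV, hV', timeIntegral]
        rw [intervalIntegral.integral_sub (hintU s) (hintU' s), Finset.sum_sub_distrib]
        ring
      · -- the Lipschitz bound `g² ≤ (√K)² e²`
        rw [Real.sq_sqrt hK, Real.sq_sqrt (hE0 _ _)]
        exact hb' _ _ i
    -- sum over coordinates
    calc ⨆ s ∈ Set.Iic t, ENNReal.ofReal (∑ i, (V i s ω - V' i s ω) ^ 2)
        ≤ ∑ i, ⨆ s ∈ Set.Iic t, ENNReal.ofReal ((V i s ω - V' i s ω) ^ 2) :=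
          vecPicard_iSup_ofReal_sum_le _ (fun i s => (V i s ω - V' i s ω) ^ 2) fun _ _ => sq_nonneg _
      _ ≤ ∑ i, (ENNReal.ofReal (2 * t * K) * (∫⁻ r in Set.Icc (0 : ℝ) t, ENNReal.ofReal (E r.toNNReal ω)) +
            2 * ⨆ s ∈ Set.Iic t, ENNReal.ofReal ((∑ n, (JV i n s ω - JV' i n s ω)) ^ 2)) :=
          Finset.sum_le_sum fun i _ => hcoord i
      _ ≤ ∑ i, (ENNReal.ofReal (2 * t * K) * (∫⁻ r in Set.Icc (0 : ℝ) t, ENNReal.ofReal (E r.toNNReal ω)) +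
            2 * ((Fintype.card κ : ℝ≥0∞) *
              ∑ n, ⨆ s ∈ Set.Iic t, ENNReal.ofReal ((JV i n s ω - JV' i n s ω) ^ 2))) := by
          gcongr with i _
          have h := iSup_ofReal_sq_sum_le (Finset.univ : Finset κ) (fun n s => JV i n s ω - JV' i n s ω)
            (Set.Iic t)
          rwa [Finset.card_univ] at h
      _ = _ := by
          rw [Finset.sum_add_distrib, Finset.sum_const, Finset.card_univ, nsmul_eq_mul, ← Finset.mul_sum,
            ← Finset.mul_sum]
  -- Step B: integrate; Doob for each martingale part
  have hsupmeas : ∀ i n, AEMeasurable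
      (fun ω => ⨆ s ∈ Set.Iic t, ENNReal.ofReal ((JV i n s ω - JV' i n s ω) ^ 2)) P := by
    intro i n
    refine aemeasurable_biSup_Iic (Z := fun s ω => JV i n s ω - JV' i n s ω)
      (φ := fun x => ENNReal.ofReal (x ^ 2)) (ENNReal.continuous_ofReal.comp (continuous_pow 2))
      (fun s => (vecPicard_measurable (hJV i n).2 s).sub (vecPicard_measurable (hJV' i n).2 s)) ?_ t
    filter_upwards [(hJV i n).1.continuous, (hJV' i n).1.continuous] with ω h1 h2
    exact h1.sub h2
  have hDoob : ∀ i n, ∫⁻ ω, ⨆ s ∈ Set.Iic t, ENNReal.ofReal ((JV i n s ω - JV' i n s ω) ^ 2) ∂P ≤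
      4 * (ENNReal.ofReal K * ∫⁻ ω, (∫⁻ r in Set.Icc (0 : ℝ) t, ENNReal.ofReal (E r.toNNReal ω)) ∂P) := by
    intro i n
    have h := IsItoIntegral.lintegral_iSup_sub_sq_le (hBm (c i n)) (hBsq (c i n)) (fun r => hB2 r (c i n))
      (hBc (c i n)) (vecPicard_isStronglyProgressive_comp hU (hσcont i n))
      (vecPicard_isStronglyProgressive_comp hU' (hσcont i n)) (hJV i n).1 (hJV' i n).1 t
    refine h.trans ?_
    gcongr
    rw [← lintegral_const_mul _ hIm]
    refine lintegral_mono fun ω => ?_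
    rw [← lintegral_const_mul' _ _ ENNReal.ofReal_ne_top]
    refine lintegral_mono fun r => ?_
    rw [← ENNReal.ofReal_mul hK]
    exact ENNReal.ofReal_le_ofReal (hσ' _ _ (i, n))
  have htK : ENNReal.ofReal (2 * t * K) ≤ ENNReal.ofReal (2 * T * K) := by
    refine ENNReal.ofReal_le_ofReal ?_
    have : (t : ℝ) ≤ T := NNReal.coe_le_coe.2 ht
    nlinarith
  -- measurability bookkeeping for splitting the integral
  have hSS : AEMeasurable (fun ω => ∑ i, ∑ n,
      ⨆ s ∈ Set.Iic t, ENNReal.ofReal ((JV i n s ω - JV' i n s ω) ^ 2)) P :=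
    Finset.aemeasurable_fun_sum _ fun i _ => Finset.aemeasurable_fun_sum _ fun n _ => hsupmeas i n
  have hsplit : ∫⁻ ω, 2 * ((Fintype.card κ : ℝ≥0∞) * ∑ i, ∑ n,
        ⨆ s ∈ Set.Iic t, ENNReal.ofReal ((JV i n s ω - JV' i n s ω) ^ 2)) ∂P =
      2 * ((Fintype.card κ : ℝ≥0∞) * ∑ i, ∑ n,
        ∫⁻ ω, ⨆ s ∈ Set.Iic t, ENNReal.ofReal ((JV i n s ω - JV' i n s ω) ^ 2) ∂P) := by
    rw [lintegral_const_mul'' _ (hSS.const_mul _), lintegral_const_mul'' _ hSS,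
      lintegral_finsetSum' _ fun i _ => Finset.aemeasurable_fun_sum _ fun n _ => hsupmeas i n]
    congr 2
    refine Finset.sum_congr rfl fun i _ => ?_
    rw [lintegral_finsetSum' _ fun n _ => hsupmeas i n]
  have hA : Measurable fun ω => (Fintype.card ι : ℝ≥0∞) * (ENNReal.ofReal (2 * t * K) *
      ∫⁻ r in Set.Icc (0 : ℝ) t, ENNReal.ofReal (E r.toNNReal ω)) := (hIm.const_mul _).const_mul _
  calc ∫⁻ ω, ⨆ s ∈ Set.Iic t, ENNReal.ofReal (∑ i, (V i s ω - V' i s ω) ^ 2) ∂P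
      ≤ ∫⁻ ω, ((Fintype.card ι : ℝ≥0∞) * (ENNReal.ofReal (2 * t * K) *
            ∫⁻ r in Set.Icc (0 : ℝ) t, ENNReal.ofReal (E r.toNNReal ω)) +
          2 * ((Fintype.card κ : ℝ≥0∞) * ∑ i, ∑ n,
            ⨆ s ∈ Set.Iic t, ENNReal.ofReal ((JV i n s ω - JV' i n s ω) ^ 2))) ∂P :=
        lintegral_mono_ae hpath
    _ = (Fintype.card ι : ℝ≥0∞) * (ENNReal.ofReal (2 * t * K) *
            ∫⁻ ω, (∫⁻ r in Set.Icc (0 : ℝ) t, ENNReal.ofReal (E r.toNNReal ω)) ∂P) +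
          2 * ((Fintype.card κ : ℝ≥0∞) * ∑ i, ∑ n,
            ∫⁻ ω, ⨆ s ∈ Set.Iic t, ENNReal.ofReal ((JV i n s ω - JV' i n s ω) ^ 2) ∂P) := by
        rw [lintegral_add_left hA, lintegral_const_mul _ (hIm.const_mul _), lintegral_const_mul _ hIm, hsplit]
    _ ≤ (Fintype.card ι : ℝ≥0∞) * (ENNReal.ofReal (2 * T * K) *
            ∫⁻ ω, (∫⁻ r in Set.Icc (0 : ℝ) t, ENNReal.ofReal (E r.toNNReal ω)) ∂P) +
          2 * ((Fintype.card κ : ℝ≥0∞) * ∑ _i : ι, ∑ _n : κ,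
            4 * (ENNReal.ofReal K * ∫⁻ ω, (∫⁻ r in Set.Icc (0 : ℝ) t, ENNReal.ofReal (E r.toNNReal ω)) ∂P)) := by
        refine add_le_add (mul_le_mul' le_rfl (mul_le_mul' htK le_rfl)) ?_
        refine mul_le_mul' le_rfl (mul_le_mul' le_rfl ?_)
        exact Finset.sum_le_sum fun i _ => Finset.sum_le_sum fun n _ => hDoob i n
    _ = _ := by
        rw [Finset.sum_const, Finset.sum_const, Finset.card_univ, Finset.card_univ, nsmul_eq_mul,
          nsmul_eq_mul]
        ring

/-- **Pathwise uniqueness for Lipschitz systems, bounded solutions** (RY IX (2.1), uniqueness half, no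
localisation), for an ARBITRARY filtration `𝓕` in which the driving coordinates `W^k` are Brownian motions in
martingale form (continuous square-integrable martingales with `(W^k)² - t` martingales; the tree's
`vecSDE_pathwise_unique_of_bounded` is the case `𝓕 = σ(W)`):
let `Y, Y'` be two coordinatewise progressive, a.s. continuous, a.s. bounded processes solving
`Y_i(t) = x₀ i + ∫₀ᵗ b_i(Y_s) ds + Σₙ J i n (t)` a.s. for all `t`, with `J i n = ∫ σ_{i n}(Y) dW^{c i n}`
(tree `IsItoIntegral`), for globally Lipschitz (sum-of-squares) `b, σ`.  Then a.s. `Y_t = Y'_t` for all `t`.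
[cite: RevuzYor1999, Ch. IX Thm (2.1)] -/
theorem vecSDE_pathwise_unique_of_bounded_filtration [IsProbabilityMeasure P]
    (hBm : ∀ k, Martingale (fun t ω => W t ω k) 𝓕 P)
    (hBsq : ∀ k, Martingale (fun t ω => W t ω k ^ 2 - (t : ℝ)) 𝓕 P)
    (hB2 : ∀ t k, MemLp (fun ω => W t ω k) 2 P) (hBc : ∀ k ω, Continuous fun t => W t ω k) (hK : 0 ≤ K)
    (hb : ∀ x y : ι → ℝ, ∑ i, (b x i - b y i) ^ 2 ≤ K * ∑ i, (x i - y i) ^ 2)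
    (hσ : ∀ x y : ι → ℝ, ∑ i, ∑ n, (σ x i n - σ y i n) ^ 2 ≤ K * ∑ i, (x i - y i) ^ 2)
    {Y Y' : ι → ℝ≥0 → Ω → ℝ} {J J' : ι → κ → ℝ≥0 → Ω → ℝ}
    (hYp : ∀ i, IsStronglyProgressive 𝓕 (Y i))
    (hYc : ∀ᵐ ω ∂P, ∀ i, Continuous fun t => Y i t ω)
    (hY'p : ∀ i, IsStronglyProgressive 𝓕 (Y' i))
    (hY'c : ∀ᵐ ω ∂P, ∀ i, Continuous fun t => Y' i t ω)
    (hJ : ∀ i n, IsItoIntegral (fun s ω => σ (fun j => Y j s ω) i n) (fun s ω => W s ω (c i n)) (J i n)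
        𝓕 P)
    (hJ' : ∀ i n, IsItoIntegral (fun s ω => σ (fun j => Y' j s ω) i n) (fun s ω => W s ω (c i n)) (J' i n)
        𝓕 P)
    (hYeq : ∀ᵐ ω ∂P, ∀ (t : ℝ≥0) (i : ι),
      Y i t ω = x₀ i + (∫ s in (0 : ℝ)..t, b (fun j => Y j s.toNNReal ω) i) + ∑ n, J i n t ω)
    (hY'eq : ∀ᵐ ω ∂P, ∀ (t : ℝ≥0) (i : ι),
      Y' i t ω = x₀ i + (∫ s in (0 : ℝ)..t, b (fun j => Y' j s.toNNReal ω) i) + ∑ n, J' i n t ω)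
    {M : ℝ} (hbd : ∀ᵐ ω ∂P, ∀ (t : ℝ≥0) (i : ι), |Y i t ω| ≤ M ∧ |Y' i t ω| ≤ M) :
    ∀ᵐ ω ∂P, ∀ (t : ℝ≥0) (i : ι), Y i t ω = Y' i t ω := by
  classical
  -- progressive versions of the Itô integrals
  have hJv : ∀ i n, ∃ V : ℝ≥0 → Ω → ℝ,
      IsItoIntegral (fun s ω => σ (fun j => Y j s ω) i n) (fun s ω => W s ω (c i n)) V 𝓕 P ∧
        IsStronglyProgressive 𝓕 V ∧ ∀ᵐ ω ∂P, ∀ t, V t ω = J i n t ω := fun i n => by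
    obtain ⟨V, h1, h2, -, h3⟩ := (hJ i n).exists_isStronglyProgressive
    exact ⟨V, h1, h2, h3⟩
  have hJv' : ∀ i n, ∃ V : ℝ≥0 → Ω → ℝ,
      IsItoIntegral (fun s ω => σ (fun j => Y' j s ω) i n) (fun s ω => W s ω (c i n)) V 𝓕 P ∧
        IsStronglyProgressive 𝓕 V ∧ ∀ᵐ ω ∂P, ∀ t, V t ω = J' i n t ω := fun i n => by
    obtain ⟨V, h1, h2, -, h3⟩ := (hJ' i n).exists_isStronglyProgressive
    exact ⟨V, h1, h2, h3⟩
  choose JV hJV1 hJV2 hJV3 using hJv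
  choose JV' hJV'1 hJV'2 hJV'3 using hJv'
  -- the Picard steps of `Y`, `Y'` with these integrals
  set V : ι → ℝ≥0 → Ω → ℝ := fun i t ω =>
    x₀ i + timeIntegral (fun s ω => b (fun j => Y j s ω) i) t ω + ∑ n, JV i n t ω with hVdef
  set V' : ι → ℝ≥0 → Ω → ℝ := fun i t ω =>
    x₀ i + timeIntegral (fun s ω => b (fun j => Y' j s ω) i) t ω + ∑ n, JV' i n t ω with hV'def
  have hJVae : ∀ᵐ ω ∂P, ∀ i n t, JV i n t ω = J i n t ω := by
    have h := fun i => (ae_all_iff.2 fun n => hJV3 i n)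
    exact (ae_all_iff.2 h).mono fun ω hω i n t => hω i n t
  have hJV'ae : ∀ᵐ ω ∂P, ∀ i n t, JV' i n t ω = J' i n t ω := by
    have h := fun i => (ae_all_iff.2 fun n => hJV'3 i n)
    exact (ae_all_iff.2 h).mono fun ω hω i n t => hω i n t
  have hVY : ∀ᵐ ω ∂P, ∀ (t : ℝ≥0) (i : ι), V i t ω = Y i t ω := by
    filter_upwards [hYeq, hJVae] with ω hω hωJ t i
    rw [hω t i, hVdef]
    simp only [timeIntegral, hωJ]
  have hV'Y' : ∀ᵐ ω ∂P, ∀ (t : ℝ≥0) (i : ι), V' i t ω = Y' i t ω := by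
    filter_upwards [hY'eq, hJV'ae] with ω hω hωJ t i
    rw [hω t i, hV'def]
    simp only [timeIntegral, hωJ]
  -- the contraction estimate
  have hcontr := fun T : ℝ≥0 => vecPicard_contraction_filtration (x₀ := x₀) hBm hBsq hB2 hBc hK hb hσ hYp hYc hY'p hY'c
    (fun i n => ⟨hJV1 i n, hJV2 i n⟩) (fun i t ω => rfl) (fun i n => ⟨hJV'1 i n, hJV'2 i n⟩)
    (fun i t ω => rfl) T
  -- the difference process `D = |Y - Y'|`
  set D : ℝ≥0 → Ω → ℝ := fun s ω => Real.sqrt (∑ i, (Y i s ω - Y' i s ω) ^ 2) with hDdef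
  have hDsq : ∀ s ω, D s ω ^ 2 = ∑ i, (Y i s ω - Y' i s ω) ^ 2 := fun s ω =>
    Real.sq_sqrt (Finset.sum_nonneg fun _ _ => sq_nonneg _)
  have hDm : Measurable (fun p : ℝ≥0 × Ω => D p.1 p.2) := by
    have h : ∀ i, Measurable (fun p : ℝ≥0 × Ω => Y i p.1 p.2 - Y' i p.1 p.2) := fun i =>
      (IsStronglyProgressive.measurable_uncurry (hYp i)).sub (IsStronglyProgressive.measurable_uncurry (hY'p i))
    exact (Finset.measurable_sum _ fun i _ => (h i).pow_const 2).sqrt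
  have hDbd : ∀ᵐ ω ∂P, ∀ s, |D s ω| ≤ Real.sqrt (Fintype.card ι * (2 * |M|) ^ 2) := by
    filter_upwards [hbd] with ω hω s
    rw [abs_of_nonneg (Real.sqrt_nonneg _)]
    refine Real.sqrt_le_sqrt ?_
    calc ∑ i, (Y i s ω - Y' i s ω) ^ 2 ≤ ∑ _i : ι, (2 * |M|) ^ 2 := by
          refine Finset.sum_le_sum fun i _ => ?_
          have h1 := (hω s i).1
          have h2 := (hω s i).2
          have h3 : |Y i s ω - Y' i s ω| ≤ 2 * |M| :=
            (abs_sub _ _).trans (by linarith [le_abs_self M])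
          rw [← sq_abs]
          exact pow_le_pow_left₀ (abs_nonneg _) h3 2
      _ = Fintype.card ι * (2 * |M|) ^ 2 := by rw [Finset.sum_const, Finset.card_univ, nsmul_eq_mul]
  -- Gronwall: `D_s = 0` a.s. for each `s`
  have hzero : ∀ (T : ℝ≥0), ∀ s ≤ T, ∀ᵐ ω ∂P, D s ω = 0 := by
    intro T
    refine ae_eq_zero_of_lintegral_iSup_sq_le hDm hDbd (T := T)
      (C := (Fintype.card ι : ℝ≥0∞) * ENNReal.ofReal (2 * T * K) +
        8 * (Fintype.card ι : ℝ≥0∞) * (Fintype.card κ : ℝ≥0∞) ^ 2 * ENNReal.ofReal K) ?_ fun t ht => ?_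
    · exact ENNReal.add_ne_top.2 ⟨ENNReal.mul_ne_top (ENNReal.natCast_ne_top _) ENNReal.ofReal_ne_top,
        ENNReal.mul_ne_top (ENNReal.mul_ne_top (ENNReal.mul_ne_top (by norm_num) (ENNReal.natCast_ne_top _))
          (ENNReal.pow_ne_top (ENNReal.natCast_ne_top _))) ENNReal.ofReal_ne_top⟩
    · have h1 := hcontr T t ht
      have hlhs : (∫⁻ ω, ⨆ s ∈ Set.Iic t, ENNReal.ofReal (D s ω ^ 2) ∂P) =
          ∫⁻ ω, ⨆ s ∈ Set.Iic t, ENNReal.ofReal (∑ i, (V i s ω - V' i s ω) ^ 2) ∂P := by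
        refine lintegral_congr_ae ?_
        filter_upwards [hVY, hV'Y'] with ω h h'
        simp only [hDsq, h, h']
      have hrhs : (∫⁻ ω, (∫⁻ r in Set.Icc (0 : ℝ) t, ENNReal.ofReal (D r.toNNReal ω ^ 2)) ∂P) =
          ∫⁻ ω, (∫⁻ r in Set.Icc (0 : ℝ) t,
            ENNReal.ofReal (∑ i, (Y i r.toNNReal ω - Y' i r.toNNReal ω) ^ 2)) ∂P := by
        simp only [hDsq]
      rw [hlhs, hrhs]
      exact h1
  -- for each time, a.s. equality of all coordinates
  have hfix : ∀ s : ℝ≥0, ∀ᵐ ω ∂P, ∀ i, Y i s ω = Y' i s ω := by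
    intro s
    filter_upwards [hzero s s le_rfl] with ω hω i
    have h0 : ∑ j, (Y j s ω - Y' j s ω) ^ 2 = 0 := by rw [← hDsq, hω]; ring
    have := (Finset.sum_eq_zero_iff_of_nonneg fun j _ => sq_nonneg (Y j s ω - Y' j s ω)).1 h0 i
      (Finset.mem_univ _)
    exact sub_eq_zero.1 (pow_eq_zero_iff two_ne_zero |>.1 this)
  -- all rational times at once, then all times by continuity
  have hrat : ∀ᵐ ω ∂P, ∀ (q : ℚ) (i : ι), Y i ((q : ℝ).toNNReal) ω = Y' i ((q : ℝ).toNNReal) ω :=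
    ae_all_iff.2 fun q => hfix _
  filter_upwards [hrat, hYc, hY'c] with ω hq hc hc' t i
  have := eq_of_eq_on_rat (hc i) (hc' i) fun q => hq q i
  exact congrFun this t

end Summit.QuantumFields.YangMills.Theorems.ColdStartUniversality

end
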